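import Summits.QuantumFields.BalabanUV.Beta.FP.NestedStepLawTorusTransportedRowsGradedSymULow
import Summits.QuantumFields.BalabanUV.Beta.FP.TorusGeneratorIntertwiningTwo
import Summits.QuantumFields.BalabanUV.Beta.FP.TorusOneShotFPExponential

/-!
# `BalabanUV.Beta.FP.NestedStepLawTorusTransportedRowsGradedGenSymULow` — road «FP» for binder row D1, ROUTE T, presentation T-β, option (δ) «LIFT ∕ GRADED»
# (R-FP-54′), an2's (J-a) programme item (β-b′) ON THE uLow BOTTOM: **THE (III′) TORUS CALL WITH leaf-02's ROWS, THE WHOLE GENERATOR SIDE `j1 j2 uC uP'`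
# AND THE FINE BLOCK's FADDEEV–POPOV LETTER `uLow` DISCHARGED BY TERM — NO SMALL-COMB DEAD ROWS LEFT** — identical to `…RowsGradedGenSym` except that it sits
# on `…RowsGradedSymULow` and discharges `uLow` by leaf-06 g21's `NestedFPSplit.torus_uLow_exp (ctrOff_mem_box _) hτ₁ hD₁ D₂ c h (hW₁.trans (weightedJet_eq …)) hW₂`
# (OFFER O-d1leaf06g21-1 l.44553: automatic for the exponential generator jets along ANY direction `h`).  After it the graded (STEP) door at the (III′)
# literal displays TABLES ONLY + the (γ-sym) sockets `h1 h2` + the coarse order-2 dead row `t2`.  The rest of this docstring is (β-b′)'s.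

WHAT.  `NestedStepLawTorusTransportedRowsGradedSym.secondVar_oneShot_nestedStepLaw_torus_transported_graded_rows_sym` ((β-b), leaf-02 g21) is the (III′) torus
call with leaf-02's one-sided rows `a0 c1 d1 t1 q1`, leaf-06's `j1` and `hH₀t` supplied by term; it still displays the order-2 intertwining `j2`, the
unimodularity `uC` of the parameter transport and the one-shot chart's (UNI)-jet letter `uP'`, with `W₂ W′₂ C₂` FREE.  leaf-06's three producers are
chart-free and ROOT-GENERIC (the roots enter only through the types `Res (toSite r) ∕ Res (toSite r′)` and the box memberships `hr hr′`), so they apply at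
the centred roots `r = r′ = ctrOff (d+1) Lc` (`ctr (d+1) Lc = toSite (ctrOff (d+1) Lc)` definitionally; `AveragingContoursRooted.ctrOff_mem_box`) UNCHANGED:

* `j2` — `TorusGeneratorIntertwiningTwo.torus_j2` (p323313), with the nested chart's generator second jet `W₂ = of((c·h b)²·Tip b e)` and the one-shot chart's
  `W′₂ = of((c·(h + Dλ) b)²·Tip b e)` in closed form, `C₂ := (c•C₁)·(c•C₁)`;
* `uC` — `TorusGeneratorIntertwining.torus_uC_exp` (p320573);
* `uP'` — `TorusOneShotFPExponential.torus_uP_exp` (p324263) at `w := h + Dλ`, `hr = hr′ := ctrOff_mem_box _` (its `hP` is (β-b)'s `hP` on the nose).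

This file is ONE theorem **`secondVar_oneShot_nestedStepLaw_torus_transported_graded_rows_gen_sym`** = (β-b)'s theorem with `W₂ W′₂` bound by those closed
forms (`hW₂ hW'₂`, leaf-06's spellings at the centred roots), `C₂ := (c•C₁)·(c•C₁)` substituted, and the binders `j2 uC uP'` REMOVED.  Proof = ONE TERM (the
rooted Gen file's term under the (J-a) substitution).  [folklore] composition BY NAME; nothing of leaf-06's restated; no `def`, no `def … : Prop`, nothing
cited, 0 sorry.

What STAYS displayed — TABLES ONLY + SOCKETS: the (γ-sym) sockets `h1 h2` (leaf-05 g29 `torus_h1_comb ∕ torus_h2_comb_record`; the closing instance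
re-displays #12's `hfμ′ hcoarse′` for `h2`), the graded form words `k1 k2` (`H₁` FREE), the order-2 composite word `q2`, the parities `hH₁t hH₂t`, the graded
Ward rows `a1 a2` (read at `Y₀ = 0`), the covariance rows `c2 d2`, the nested dead rows `s1 s2 t2`, the namings `hΓ hI hL hS hB`.  Whether the (III′)
literal's chart transport IS this exponential diagonal `λ`-multiplication is the dictionary's ∕ OWNER's word, not claimed here.

HONEST DEPENDENCY (page 1, mandatory): continuum YM on T⁴ ⇐ BetaPertH ∧ nine spine estimates (0/9 proved); BetaPertH ⇐ (D1) ∧ (D4) ∧ CAP+tail;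
G-an2-4 gates asym, D1 and NE2/3/4.  HONEST FRAMING (cell contract, verbatim): «discharging `BetaPertH` makes Bałaban's UV stability UNCONDITIONAL —
a real constructive-QFT result; it is NOT the continuum limit and NOT the Clay problem.»  ABSOLUTE RULE (cell charter, verbatim): «No internally-minted
statement may enter as a cited fact. Every hypothesis is either kernel-proved in this package or a verbatim quotation of a PUBLISHED theorem with page
reference. The manuscript(s) under audit are NOT citable for their own disputed steps — they are the thing under adjudication; programme-internal
(2001/route/tribunal) claims are never citable.»  0 estimates; 0∕4 row-D1 binders; NOT (T-ID)∕(T-β) complete, NOT (J-a) complete, NOT SDF, NOT D1, NOT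
BetaPertH, NOT continuum, NOT Clay.  Road «FP», D1 formalisation swarm leaf-02 (b2b-balaban-beta-d1-formalise-leaf-02) gen 21, 2026-08-22.  No existing file
touched.
-/

noncomputable section

open scoped BigOperators Matrix

namespace Summit.QuantumFields.BalabanUV.Beta.FP.NestedStepLawTorusTransportedRowsGradedGenSymULow

open Matrix Finset
open Literature.Probability.LatticeModels (Torus.proj)
open Literature.MathematicalPhysics.QuantumFieldTheory.Balaban1983to89
open Literature.MathematicalPhysics.QuantumFieldTheory.Balaban1983to89.Beta
open Literature.MathematicalPhysics.QuantumFieldTheory.Balaban1983to89.Beta.Composition (kkt)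
open Literature.MathematicalPhysics.QuantumFieldTheory.Balaban1983to89.Beta.CompositionSingular (effForm flucCov minOp minOpL)
open Literature.MathematicalPhysics.QuantumFieldTheory.LatticeForm (quo)
open B5Prop11Plancherel (fine)
open B6Lemma24Torus (pbox mem_pbox)
open AffineAveraging (Site box toSite unitVec)
open AveragingContoursRooted (ctr ctrOff ctrOff_mem_box)
open SymAveragingHessianCounts (symVhSAt)
open OneStepResolventKernel (Fib)
open Summit.QuantumFields.BalabanUV.Beta.BorderedHessian (bhKStepAt stepScale)
open Summit.QuantumFields.BalabanUV.Beta.DshAn1 (Dsh)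
open Summit.QuantumFields.BalabanUV.Beta.SymShiftedSpread (bhKStepSh)
open Summit.QuantumFields.BalabanUV.Beta.D1BFx.LogDetSecondVariation (secondVar)
open Summit.QuantumFields.BalabanUV.Beta.FP.KernelPeriodisationFib (Idx perF)
open Summit.QuantumFields.BalabanUV.Beta.FP.KernelPeriodisationFibLoc (dper)
open Summit.QuantumFields.BalabanUV.Beta.FP.TorusGaugeCovariance (tdelta tgrad)
open Summit.QuantumFields.BalabanUV.Beta.FP.TorusGaugeCovarianceCoarse (coarsePt tgradBlock)
open Summit.QuantumFields.BalabanUV.Beta.FP.TorusCombRows (Res combRowsT combBondT)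
open Summit.QuantumFields.BalabanUV.Beta.FP.TorusCombNestedBasis (resBigEquiv)
open Summit.QuantumFields.BalabanUV.Beta.GAN24.FineReadoutCauchyFrame (toSite_mem_range)
open Summit.QuantumFields.BalabanUV.Beta.FP.NestedStepLawTorusTransportedRowsGradedSymULow (secondVar_oneShot_nestedStepLaw_torus_transported_graded_rows_sym_uLow)
open Summit.QuantumFields.BalabanUV.Beta.FP.NestedFPSplit (torus_uLow_exp)
open Summit.QuantumFields.BalabanUV.Beta.FP.TorusGeneratorIntertwining (torus_uC_exp weightedJet_eq)
open Summit.QuantumFields.BalabanUV.Beta.FP.TorusGeneratorIntertwiningTwo (torus_j2)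
open Summit.QuantumFields.BalabanUV.Beta.FP.TorusOneShotFPExponential (torus_uP_exp)

variable {d : ℕ} (M' : Fin (d + 1) → ℕ) [∀ μ, NeZero (M' μ)] {Lc : ℕ} [NeZero Lc]

set_option synthInstance.maxSize 1024 in
/-- [folklore] **THE (III′) TORUS CALL (uLow BOTTOM) WITH leaf-02's ROWS, THE GENERATOR SIDE `j1 j2 uC uP'` AND `uLow` ALL DISCHARGED BY TERM** — as (β-b′)'s theorem, minus `s1 s2`.  (β-b)'s
`secondVar_oneShot_nestedStepLaw_torus_transported_graded_rows_sym` with the nested chart's generator second jet along `h` and the one-shot chart's along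
`h + Dλ` bound in the exponential closed forms `hW₂ hW'₂` (leaf-06 `torus_j2`'s spellings at the centred roots), `C₂ := (c•C₁)·(c•C₁)`, and the binders
`j2 uC uP'` REMOVED — supplied inside by leaf-06's `torus_j2` (after `weightedJet_eq`), `torus_uC_exp`, `torus_uP_exp` (at `w := h + Dλ`,
`hr = hr′ := ctrOff_mem_box _`).  Displayed: the sockets `h1 h2`, tables only (`k1 k2 q2 hH₁t hH₂t a1 a2 c2 d2`), the nested dead rows `s1 s2 t2`, the namings.
Conclusion VERBATIM (β-b)'s. -/
theorem secondVar_oneShot_nestedStepLaw_torus_transported_graded_rows_gen_sym_uLow (hM' : ∀ i, Lc ∣ M' i) (j : ℕ)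
    {κ : Type*} [Fintype κ] [DecidableEq κ] (pμ' : κ → ↥(pbox M')) (mμ' : κ → Fin (d + 1))
    -- the torus objects of record, by defining equations
    {H₀ : Matrix (↥(pbox (fine Lc M')) × Fin (d + 1)) (↥(pbox (fine Lc M')) × Fin (d + 1)) ℝ}
    {Q₁₀ : Matrix (↥(pbox M') × Fin (d + 1)) (↥(pbox (fine Lc M')) × Fin (d + 1)) ℝ}
    {τ₁ : Matrix (Res (ctr (d + 1) Lc) Lc (fine Lc M')) (↥(pbox (fine Lc M')) × Fin (d + 1)) ℝ}
    {τ₂ : Matrix (Res (ctr (d + 1) Lc) Lc M') (↥(pbox M') × Fin (d + 1)) ℝ}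
    {D₁ : Matrix (↥(pbox (fine Lc M')) × Fin (d + 1)) (Res (ctr (d + 1) Lc) Lc (fine Lc M')) ℝ}
    {D₂ : Matrix (↥(pbox (fine Lc M')) × Fin (d + 1)) (Res (ctr (d + 1) Lc) Lc M') ℝ}
    {Dbar : Matrix (↥(pbox M') × Fin (d + 1)) (Res (ctr (d + 1) Lc) Lc M') ℝ}
    {P : Matrix (Res (ctr (d + 1) Lc) Lc M' ⊕ Res (ctr (d + 1) Lc) Lc (fine Lc M')) (↥(pbox (fine Lc M')) × Fin (d + 1)) ℝ}
    (hH₀ : H₀ = (perF (fine Lc M') (bhKStepSh d Lc (Dsh Lc) j)).submatrix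
        (fun b : ↥(pbox (fine Lc M')) × Fin (d + 1) => ((b.1, Sum.inl b.2) : Idx (fine Lc M') (Fib d)))
        (fun b : ↥(pbox (fine Lc M')) × Fin (d + 1) => ((b.1, Sum.inl b.2) : Idx (fine Lc M') (Fib d))))
    (hQ₁₀ : Q₁₀ = (perF (fine Lc M') (bhKStepSh d Lc (Dsh Lc) j)).submatrix
        (fun a : ↥(pbox M') × Fin (d + 1) => ((coarsePt M' Lc a.1, Sum.inr a.2) : Idx (fine Lc M') (Fib d)))
        (fun b : ↥(pbox (fine Lc M')) × Fin (d + 1) => ((b.1, Sum.inl b.2) : Idx (fine Lc M') (Fib d))))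
    (hτ₁ : τ₁ = (combRowsT (ctr (d + 1) Lc) Lc (fine Lc M')).submatrix id
        (fun b : ↥(pbox (fine Lc M')) × Fin (d + 1) => ((b.1, Sum.inl b.2) : Idx (fine Lc M') (Fib d))))
    (hτ₂ : τ₂ = (combRowsT (ctr (d + 1) Lc) Lc M').submatrix id (fun b : ↥(pbox M') × Fin (d + 1) => ((b.1, Sum.inl b.2) : Idx M' (Fib d))))
    (hD₁ : D₁ = (tgrad (fine Lc M')).submatrix (fun b : ↥(pbox (fine Lc M')) × Fin (d + 1) => ((b.1, Sum.inl b.2) : Idx (fine Lc M') (Fib d)))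
        (Subtype.val : Res (ctr (d + 1) Lc) Lc (fine Lc M') → ↥(pbox (fine Lc M'))))
    (hD₂ : D₂ = (tgradBlock M' Lc).submatrix (fun b : ↥(pbox (fine Lc M')) × Fin (d + 1) => ((b.1, Sum.inl b.2) : Idx (fine Lc M') (Fib d)))
        (Subtype.val : Res (ctr (d + 1) Lc) Lc M' → ↥(pbox M')))
    (hDbar : Dbar = Matrix.of fun (a : ↥(pbox M') × Fin (d + 1)) (t : Res (ctr (d + 1) Lc) Lc M') =>
        stepScale d Lc j * (((box (d + 1) Lc).card : ℝ) * tgrad M' (a.1, Sum.inl a.2) t.1))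
    (hP : P = (combRowsT ((Lc : ℤ) • ctr (d + 1) Lc + ctr (d + 1) Lc) (Lc * Lc) (fine Lc M')).submatrix
        (resBigEquiv Lc Lc (ctr (d + 1) Lc) (ctr (d + 1) Lc) M' (Nat.pos_of_ne_zero (NeZero.ne Lc)) (toSite_mem_range (ctrOff_mem_box (Nat.one_le_iff_ne_zero.mpr (NeZero.ne Lc))))
          (Nat.pos_of_ne_zero (NeZero.ne Lc)) (toSite_mem_range (ctrOff_mem_box (Nat.one_le_iff_ne_zero.mpr (NeZero.ne Lc))))).symm
        (fun b : ↥(pbox (fine Lc M')) × Fin (d + 1) => ((b.1, Sum.inl b.2) : Idx (fine Lc M') (Fib d))))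
    -- the displayed jets: form, averaging (both levels), block covariance, generators (fine and coarse), Ward witnesses
    (H₁ H₂ : Matrix (↥(pbox (fine Lc M')) × Fin (d + 1)) (↥(pbox (fine Lc M')) × Fin (d + 1)) ℝ)
    {Q₂₀ : Matrix κ (↥(pbox M') × Fin (d + 1)) ℝ}
    (hQ₂₀ : Q₂₀ = (perF M' (bhKStepSh d Lc (Dsh Lc) (j + 1))).submatrix (fun a : κ => ((pμ' a, Sum.inr (mμ' a)) : Idx M' (Fib d)))
        (fun b : ↥(pbox M') × Fin (d + 1) => ((b.1, Sum.inl b.2) : Idx M' (Fib d))))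
    -- leaf-02's ORDER-1 ROWS ALONG A DIRECTION `h` AND THE GAUGE PARAMETER `λ` OF THE CHART TRANSPORT: the insertion-table families (fine, and coarse
    -- transported by `θ_j·Q₁₀`), the generator jet and the coarse jet by their defining equations (p314580, `PeriodisedCoarseWardContact`, `NestedStepLawTorusInstanceRows`)
    (h : ↥(pbox (fine Lc M')) × Fin (d + 1) → ℝ) (lam : ↥(pbox (fine Lc M')) → ℝ)
    (Q₁₁ : (↥(pbox (fine Lc M')) × Fin (d + 1) → ℝ) → Matrix (↥(pbox M') × Fin (d + 1)) (↥(pbox (fine Lc M')) × Fin (d + 1)) ℝ)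
    (hQ₁₁ : ∀ w, Q₁₁ w = ∑ b : ↥(pbox (fine Lc M')) × Fin (d + 1), w b •
        (perF (fine Lc M') (dper (fine Lc M') (symVhSAt (ctr (d + 1) Lc) d Lc rfl b.2 (b.1 : Site (d + 1))))).submatrix
          (fun a : ↥(pbox M') × Fin (d + 1) => ((coarsePt M' Lc a.1, Sum.inr a.2) : Idx (fine Lc M') (Fib d)))
          (fun b : ↥(pbox (fine Lc M')) × Fin (d + 1) => ((b.1, Sum.inl b.2) : Idx (fine Lc M') (Fib d))))
    (Q₂₁ : (↥(pbox (fine Lc M')) × Fin (d + 1) → ℝ) → Matrix κ (↥(pbox M') × Fin (d + 1)) ℝ)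
    (hQ₂₁ : ∀ w, Q₂₁ w = ∑ b : ↥(pbox (fine Lc M')) × Fin (d + 1), w b •
        ∑ a' : ↥(pbox M') × Fin (d + 1), (stepScale d Lc (j + 1) / (stepScale d Lc j ^ 2 * ((box (d + 1) Lc).card : ℝ)) * Q₁₀ a' b) •
          (perF M' (dper M' (symVhSAt (ctr (d + 1) Lc) d Lc rfl a'.2 (a'.1 : Site (d + 1))))).submatrix (fun a : κ => ((pμ' a, Sum.inr (mμ' a)) : Idx M' (Fib d)))
            (fun b : ↥(pbox M') × Fin (d + 1) => ((b.1, Sum.inl b.2) : Idx M' (Fib d))))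
    {W₁ : Matrix (↥(pbox (fine Lc M')) × Fin (d + 1)) (Res (ctr (d + 1) Lc) Lc M' ⊕ Res (ctr (d + 1) Lc) Lc (fine Lc M')) ℝ}
    (hW₁ : W₁ = ∑ b : ↥(pbox (fine Lc M')) × Fin (d + 1), h b •
        Matrix.of (fun (b' : ↥(pbox (fine Lc M')) × Fin (d + 1)) (e : Res (ctr (d + 1) Lc) Lc M' ⊕ Res (ctr (d + 1) Lc) Lc (fine Lc M')) =>
          if b' = b then
            -((((Lc : ℝ) ^ (d + 1) * stepScale d Lc j)⁻¹)
              * Sum.elim (fun t : Res (ctr (d + 1) Lc) Lc M' => tdelta M' (quo Lc ((b.1 : Site (d + 1)) + unitVec b.2)) t.1)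
                  (fun s : Res (ctr (d + 1) Lc) Lc (fine Lc M') => tdelta (fine Lc M') ((b.1 : Site (d + 1)) + unitVec b.2) s.1) e)
          else 0))
    {Db₁ : Matrix (↥(pbox M') × Fin (d + 1)) (Res (ctr (d + 1) Lc) Lc M') ℝ}
    (hDb₁ : Db₁ = ∑ b : ↥(pbox (fine Lc M')) × Fin (d + 1), h b •
        Matrix.of fun (a : ↥(pbox M') × Fin (d + 1)) (t : Res (ctr (d + 1) Lc) Lc M') =>
          -((((Lc : ℝ) ^ (d + 1) * stepScale d Lc j)⁻¹) * Q₁₀ a b * tdelta M' ((a.1 : Site (d + 1)) + unitVec a.2) t.1))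
    -- the NESTED chart's direction is average-coarse-comb-dead (the hypothesis of `torus_t1_of_average_dead`)
    (hdead : ∀ (a : ↥(pbox M') × Fin (d + 1)) (x : Res (ctr (d + 1) Lc) Lc M'),
      combBondT (ctr (d + 1) Lc) Lc M' x = ((a.1, Sum.inl a.2) : Idx M' (Fib d)) → ∑ b : ↥(pbox (fine Lc M')) × Fin (d + 1), Q₁₀ a b * h b = 0)
    -- the second-order data stay displayed
    (Q₁₂ : Matrix (↥(pbox M') × Fin (d + 1)) (↥(pbox (fine Lc M')) × Fin (d + 1)) ℝ) (Q₂₂ : Matrix κ (↥(pbox M') × Fin (d + 1)) ℝ)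
    -- leaf-06's EXPONENTIAL closed form of the nested chart's generator SECOND jet along `h` (`TorusGeneratorIntertwiningTwo.torus_j2`'s `hW₂`)
    {W₂ : Matrix (↥(pbox (fine Lc M')) × Fin (d + 1)) (Res (ctr (d + 1) Lc) Lc M' ⊕ Res (ctr (d + 1) Lc) Lc (fine Lc M')) ℝ}
    (hW₂ : W₂ = Matrix.of fun (b : ↥(pbox (fine Lc M')) × Fin (d + 1)) (e : Res (ctr (d + 1) Lc) Lc M' ⊕ Res (ctr (d + 1) Lc) Lc (fine Lc M')) =>
        ((((Lc : ℝ) ^ (d + 1) * stepScale d Lc j)⁻¹) * h b) ^ 2 * Sum.elim (fun t : Res (ctr (d + 1) Lc) Lc M' => tdelta M' (quo Lc ((b.1 : Site (d + 1)) + unitVec b.2)) t.1)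
          (fun s : Res (ctr (d + 1) Lc) Lc (fine Lc M') => tdelta (fine Lc M') ((b.1 : Site (d + 1)) + unitVec b.2) s.1) e)
    (Db₂ : Matrix (↥(pbox M') × Fin (d + 1)) (Res (ctr (d + 1) Lc) Lc M') ℝ)
    (Y₁ Y₂ : Matrix κ (Res (ctr (d + 1) Lc) Lc M' ⊕ Res (ctr (d + 1) Lc) Lc (fine Lc M')) ℝ)
    -- the chart transport (exponential currency): generators `X` (fields), `X̄` (composite multipliers); the one-shot chart's generator jets `W♯₁ W♯₂`;
    -- the parameter-transport jets `C₁ C₂`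
    {X : Matrix (↥(pbox (fine Lc M')) × Fin (d + 1)) (↥(pbox (fine Lc M')) × Fin (d + 1)) ℝ} {Xbar : Matrix κ κ ℝ}
    -- (T-β-1) at the torus: the transport generators ARE the diagonal gauge generators of the parameter `λ` (fields: `−c•E_λ`; composite multipliers: `c•R′_λ̄`)
    (hX : X = -((((Lc : ℝ) ^ (d + 1) * stepScale d Lc j)⁻¹) • Matrix.diagonal (fun b : ↥(pbox (fine Lc M')) × Fin (d + 1) => lam b.1)))
    (hXbar : Xbar = (((Lc : ℝ) ^ (d + 1) * stepScale d Lc j)⁻¹) •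
        Matrix.diagonal (fun α : κ => ∑ t : ↥(pbox M'), tdelta M' ((pμ' α : Site (d + 1)) + ctr (d + 1) Lc) t
          * (∑ s : ↥(pbox (fine Lc M')), tdelta (fine Lc M') ((Lc : ℤ) • (t : Site (d + 1)) + ctr (d + 1) Lc) s * lam s)))
    -- (T-β-4) AT THE TORUS (leaf-06 `TorusGeneratorIntertwining`): the one-shot chart's generator first jet IS the nested chart's generator jet ALONG THE
    -- GAUGE-SHIFTED DIRECTION `h + Dλ`, by its defining equation in closed form (`weightedJet_eq` currency)
    {W'₁ : Matrix (↥(pbox (fine Lc M')) × Fin (d + 1)) (Res (ctr (d + 1) Lc) Lc M' ⊕ Res (ctr (d + 1) Lc) Lc (fine Lc M')) ℝ}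
    (hW'₁ : W'₁ = Matrix.of fun (b : ↥(pbox (fine Lc M')) × Fin (d + 1)) (e : Res (ctr (d + 1) Lc) Lc M' ⊕ Res (ctr (d + 1) Lc) Lc (fine Lc M')) =>
        -((((Lc : ℝ) ^ (d + 1) * stepScale d Lc j)⁻¹) * (h b + ∑ s, tgrad (fine Lc M') (b.1, Sum.inl b.2) s * lam s)
          * Sum.elim (fun t : Res (ctr (d + 1) Lc) Lc M' => tdelta M' (quo Lc ((b.1 : Site (d + 1)) + unitVec b.2)) t.1)
            (fun s : Res (ctr (d + 1) Lc) Lc (fine Lc M') => tdelta (fine Lc M') ((b.1 : Site (d + 1)) + unitVec b.2) s.1) e))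
    -- the one-shot chart's generator SECOND jet along `h + Dλ`, exponential closed form (`torus_j2`'s `hW₂'`, `torus_uP_exp`'s `hW₂` at `w := h + Dλ`)
    {W'₂ : Matrix (↥(pbox (fine Lc M')) × Fin (d + 1)) (Res (ctr (d + 1) Lc) Lc M' ⊕ Res (ctr (d + 1) Lc) Lc (fine Lc M')) ℝ}
    (hW'₂ : W'₂ = Matrix.of fun (b : ↥(pbox (fine Lc M')) × Fin (d + 1)) (e : Res (ctr (d + 1) Lc) Lc M' ⊕ Res (ctr (d + 1) Lc) Lc (fine Lc M')) =>
        ((((Lc : ℝ) ^ (d + 1) * stepScale d Lc j)⁻¹) * (h b + ∑ s, tgrad (fine Lc M') (b.1, Sum.inl b.2) s * lam s)) ^ 2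
          * Sum.elim (fun t : Res (ctr (d + 1) Lc) Lc M' => tdelta M' (quo Lc ((b.1 : Site (d + 1)) + unitVec b.2)) t.1)
            (fun s : Res (ctr (d + 1) Lc) Lc (fine Lc M') => tdelta (fine Lc M') ((b.1 : Site (d + 1)) + unitVec b.2) s.1) e)
    -- the parameter-transport GENERATOR `C₁(λ)` by leaf-06's defining equation `hC₁` VERBATIM («multiplication by `λ` in the gauge-mode basis»: `diagonal λ̄`
    -- on the coarse residual parameters, `diagonal (λ∘val)` on the fine ones, coarse-to-fine block `(λ s − λ̄ t)·[block s = t]`); the transport is `c • C₁`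
    {C₁ : Matrix (Res (ctr (d + 1) Lc) Lc M' ⊕ Res (ctr (d + 1) Lc) Lc (fine Lc M')) (Res (ctr (d + 1) Lc) Lc M' ⊕ Res (ctr (d + 1) Lc) Lc (fine Lc M')) ℝ}
    (hC₁ : C₁ = Matrix.fromBlocks
        (Matrix.diagonal fun t : Res (ctr (d + 1) Lc) Lc M' =>
          ∑ s, tdelta (fine Lc M') ((Lc : ℤ) • ((t.1 : ↥(pbox M')) : Site (d + 1)) + ctr (d + 1) Lc) s * lam s)
        (0 : Matrix (Res (ctr (d + 1) Lc) Lc M') (Res (ctr (d + 1) Lc) Lc (fine Lc M')) ℝ)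
        (Matrix.of fun (s : Res (ctr (d + 1) Lc) Lc (fine Lc M')) (t : Res (ctr (d + 1) Lc) Lc M') =>
          (lam s.1 - ∑ s', tdelta (fine Lc M') ((Lc : ℤ) • ((t.1 : ↥(pbox M')) : Site (d + 1)) + ctr (d + 1) Lc) s' * lam s')
            * tdelta M' (quo Lc ((s.1 : ↥(pbox (fine Lc M'))) : Site (d + 1))) t.1)
        (Matrix.diagonal fun s : Res (ctr (d + 1) Lc) Lc (fine Lc M') => lam s.1))
    {𝔔₀ 𝔔₁ 𝔔₂ : Matrix κ (↥(pbox (fine Lc M')) × Fin (d + 1)) ℝ}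
    (h𝔔₀ : Q₂₀ * Q₁₀ = 𝔔₀) (h𝔔₁ : Q₂₁ h * Q₁₀ + Q₂₀ * Q₁₁ h = 𝔔₁)
    (h𝔔₂ : Q₂₂ * Q₁₀ + Q₂₁ h * Q₁₁ h + (Q₂₁ h * Q₁₁ h + Q₂₀ * Q₁₂) = 𝔔₂)
    -- (T-β-1) GRADED: the ONE-SHOT literal's composite jets are the graded `X`-conjugated words of the nested-chart jets (`𝔎 = H`: δ-constrained), NAMED
    {H'₁ H'₂ : Matrix (↥(pbox (fine Lc M')) × Fin (d + 1)) (↥(pbox (fine Lc M')) × Fin (d + 1)) ℝ}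
    {𝔔'₁ 𝔔'₂ : Matrix κ (↥(pbox (fine Lc M')) × Fin (d + 1)) ℝ}
    -- `q1` DISCHARGED (`PeriodisedCompositeIndexWard.torus_q1_letter`): the one-shot literal's first composite averaging jet IS the composite insertion jet
    -- along the GAUGE-SHIFTED direction `h + Dλ`, NAMED
    (h𝔔'₁ : Q₂₁ (fun b => h b + ∑ s : ↥(pbox (fine Lc M')), tgrad (fine Lc M') (b.1, Sum.inl b.2) s * lam s) * Q₁₀
        + Q₂₀ * Q₁₁ (fun b => h b + ∑ s : ↥(pbox (fine Lc M')), tgrad (fine Lc M') (b.1, Sum.inl b.2) s * lam s) = 𝔔'₁)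
    (k1 : -(Xᵀ * H₀) + H₁ + H₀ * X = H'₁)
    (k2 : (X * X)ᵀ * H₀ + (-(Xᵀ * H₁) + -(Xᵀ * H₀ * X)) + ((-(Xᵀ * H₁) + -(Xᵀ * H₀ * X)) + (H₂ + H₁ * X + (H₁ * X + H₀ * (X * X)))) = H'₂)
    (q2 : Xbar * Xbar * 𝔔₀ + (Xbar * 𝔔₁ + Xbar * 𝔔₀ * X) + ((Xbar * 𝔔₁ + Xbar * 𝔔₀ * X) + (𝔔₂ + 𝔔₁ * X + (𝔔₁ * X + 𝔔₀ * (X * X)))) = 𝔔'₂)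
    -- (T-β-4) `j1 j2 uC`, the one-shot (UNI)-jet letter `uP'` AND the fine block's FP letter `uLow` DISCHARGED (leaf-06); NO small-comb dead rows;
    -- the order-2 coarse comb row of the average stays (`t1` DISCHARGED)
    (t2 : τ₂ * (Q₁₂ * fromCols D₂ D₁ + (2 : ℝ) • (Q₁₁ h * W₁) + Q₁₀ * W₂) = 0)
    -- the parities of the displayed form jets (`H₀ᵀ = H₀` is a theorem, discharged inside the graded call: `PeriodisedWardOrderZero.torus_H₀_transpose`)
    (hH₁t : H₁ᵀ = -H₁) (hH₂t : H₂ᵀ = H₂)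
    -- the GRADED second-order composite Ward TABLE IDENTITIES (δ-constrained: `𝔎 = H`; the door's one-sided graded shapes, `W₀ := [D₂ | D₁]`), read at
    -- `Y₀ = 0`; orders 1 and 2 only (order 0 `a0` DISCHARGED: `PeriodisedWardOrderZero.torus_a0_letter`); NO transposed rows
    (a1 : H₁ * fromCols D₂ D₁ + H₀ * W₁ = 𝔔₀ᵀ * Y₁)
    (a2 : H₂ * fromCols D₂ D₁ + (2 : ℝ) • (H₁ * W₁) + H₀ * W₂ = -((2 : ℝ) • (𝔔₁ᵀ * Y₁)) + 𝔔₀ᵀ * Y₂)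
    -- the insertion-table covariance TABLE IDENTITIES and the coarse covariance identities (order 0 discharged in p316503)
    -- order 2 only (order 1 `c1 d1` DISCHARGED: p314580, `PeriodisedCoarseWardContact`)
    (c2 : Q₁₂ * fromCols D₂ D₁ + (2 : ℝ) • (Q₁₁ h * W₁) + Q₁₀ * W₂ = fromCols Db₂ 0)
    (d2 : Q₂₂ * Dbar + (2 : ℝ) • (Q₂₁ h * Db₁) + Q₂₀ * Db₂ = 0)
    -- block namings and the coarse non-degeneracy
    {Γ : Matrix (↥(pbox (fine Lc M')) × Fin (d + 1)) (↥(pbox (fine Lc M')) × Fin (d + 1)) ℝ}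
    {I : Matrix (↥(pbox (fine Lc M')) × Fin (d + 1)) ((↥(pbox M') × Fin (d + 1)) ⊕ Res (ctr (d + 1) Lc) Lc (fine Lc M')) ℝ}
    {L : Matrix ((↥(pbox M') × Fin (d + 1)) ⊕ Res (ctr (d + 1) Lc) Lc (fine Lc M')) (↥(pbox (fine Lc M')) × Fin (d + 1)) ℝ}
    {S : Matrix ((↥(pbox M') × Fin (d + 1)) ⊕ Res (ctr (d + 1) Lc) Lc (fine Lc M')) ((↥(pbox M') × Fin (d + 1)) ⊕ Res (ctr (d + 1) Lc) Lc (fine Lc M')) ℝ}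
    {B : Matrix ((↥(pbox M') × Fin (d + 1)) ⊕ Res (ctr (d + 1) Lc) Lc (fine Lc M')) (↥(pbox (fine Lc M')) × Fin (d + 1)) ℝ}
    (hΓ : flucCov H₀ (fromRows Q₁₀ τ₁) = Γ) (hI : minOp H₀ (fromRows Q₁₀ τ₁) = I) (hL : minOpL H₀ (fromRows Q₁₀ τ₁) = L) (hS : effForm H₀ (fromRows Q₁₀ τ₁) = S)
    (hB : fromRows (Q₁₁ h) (0 : Matrix (Res (ctr (d + 1) Lc) Lc (fine Lc M')) (↥(pbox (fine Lc M')) × Fin (d + 1)) ℝ) = B)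
    -- (γ-sym) SOCKETS DISPLAYED (leaf-05 g29: `torus_h1_comb` ∕ `torus_h2_comb_record` at the sym tables)
    (h1 : (kkt H₀ (fromRows Q₁₀ τ₁)).det ≠ 0) (h2 : (kkt S.toBlocks₁₁ (fromRows Q₂₀ τ₂)).det ≠ 0) :
    secondVar (kkt H₀ (fromRows 𝔔₀ P))
        (fromBlocks H'₁ (-(fromRows 𝔔'₁ (0 : Matrix (Res (ctr (d + 1) Lc) Lc M' ⊕ Res (ctr (d + 1) Lc) Lc (fine Lc M')) (↥(pbox (fine Lc M')) × Fin (d + 1)) ℝ))ᵀ)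
          (fromRows 𝔔'₁ (0 : Matrix (Res (ctr (d + 1) Lc) Lc M' ⊕ Res (ctr (d + 1) Lc) Lc (fine Lc M')) (↥(pbox (fine Lc M')) × Fin (d + 1)) ℝ)) 0)
        (kkt H'₂ (fromRows 𝔔'₂ (0 : Matrix (Res (ctr (d + 1) Lc) Lc M' ⊕ Res (ctr (d + 1) Lc) Lc (fine Lc M')) (↥(pbox (fine Lc M')) × Fin (d + 1)) ℝ)))
      = secondVar (kkt H₀ (fromRows Q₁₀ τ₁)) (fromBlocks H₁ (-Bᵀ) B 0)
            (kkt H₂ (fromRows Q₁₂ (0 : Matrix (Res (ctr (d + 1) Lc) Lc (fine Lc M')) (↥(pbox (fine Lc M')) × Fin (d + 1)) ℝ)))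
        + secondVar
            (kkt S.toBlocks₁₁ (fromRows Q₂₀ τ₂))
            (fromBlocks ((L * H₁ - S * B) * I + L * Bᵀ * S).toBlocks₁₁ (-(fromRows (Q₂₁ h) (0 : Matrix (Res (ctr (d + 1) Lc) Lc M') (↥(pbox M') × Fin (d + 1)) ℝ))ᵀ)
              (fromRows (Q₂₁ h) (0 : Matrix (Res (ctr (d + 1) Lc) Lc M') (↥(pbox M') × Fin (d + 1)) ℝ)) 0)
            (kkt (((-((L * H₁ - S * B) * Γ - L * Bᵀ * L) * H₁ + L * H₂
                      - (((L * H₁ - S * B) * I + L * Bᵀ * S) * B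
                          + S * fromRows Q₁₂ (0 : Matrix (Res (ctr (d + 1) Lc) Lc (fine Lc M')) (↥(pbox (fine Lc M')) × Fin (d + 1)) ℝ))) * I
                    + (L * H₁ - S * B) * (-((Γ * H₁ + I * B) * I + Γ * Bᵀ * S)))
                  - ((-((L * H₁ - S * B) * Γ - L * Bᵀ * L) * (-Bᵀ)
                        + L * (fromRows Q₁₂ (0 : Matrix (Res (ctr (d + 1) Lc) Lc (fine Lc M')) (↥(pbox (fine Lc M')) × Fin (d + 1)) ℝ))ᵀ) * S
                      + L * (-Bᵀ) * ((L * H₁ - S * B) * I + L * Bᵀ * S))).toBlocks₁₁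
              (fromRows Q₂₂ (0 : Matrix (Res (ctr (d + 1) Lc) Lc M') (↥(pbox M') × Fin (d + 1)) ℝ))) :=
  secondVar_oneShot_nestedStepLaw_torus_transported_graded_rows_sym_uLow M' hM' j pμ' mμ' hH₀ hQ₁₀ hτ₁ hτ₂ hD₁ hD₂ hDbar hP H₁ H₂ hQ₂₀ h lam
    Q₁₁ hQ₁₁ Q₂₁ hQ₂₁ hW₁ hDb₁ hdead Q₁₂ Q₂₂ W₂ Db₂ Y₁ Y₂ hX hXbar hW'₁ W'₂ hC₁ (((((Lc : ℝ) ^ (d + 1) * stepScale d Lc j)⁻¹) • C₁) * ((((Lc : ℝ) ^ (d + 1) * stepScale d Lc j)⁻¹) • C₁)) h𝔔₀ h𝔔₁ h𝔔₂ h𝔔'₁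
    k1 k2 q2
    -- `j2` BY TERM: leaf-06's `torus_j2` (the product rule twice + the tip rule), fed the summed `W₁` via `weightedJet_eq`, at the centred roots
    (torus_j2 M' lam (((Lc : ℝ) ^ (d + 1) * stepScale d Lc j)⁻¹) h hD₁ hD₂ hC₁ hX
      (hW₁.trans (weightedJet_eq M' (((Lc : ℝ) ^ (d + 1) * stepScale d Lc j)⁻¹) h
        (fun (b : ↥(pbox (fine Lc M')) × Fin (d + 1)) (e : Res (ctr (d + 1) Lc) Lc M' ⊕ Res (ctr (d + 1) Lc) Lc (fine Lc M')) =>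
          Sum.elim (fun t : Res (ctr (d + 1) Lc) Lc M' => tdelta M' (quo Lc ((b.1 : Site (d + 1)) + unitVec b.2)) t.1)
            (fun s : Res (ctr (d + 1) Lc) Lc (fine Lc M') => tdelta (fine Lc M') ((b.1 : Site (d + 1)) + unitVec b.2) s.1) e)))
      hW'₁ hW₂ hW'₂)
    -- `uC` BY TERM: leaf-06's `torus_uC_exp` at the exponential second parameter jet
    (torus_uC_exp (((Lc : ℝ) ^ (d + 1) * stepScale d Lc j)⁻¹) C₁)
    -- `uP'` BY TERM: leaf-06's `torus_uP_exp` along `w := h + Dλ`, at the centred roots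
    (torus_uP_exp M' (ctrOff_mem_box (Nat.one_le_iff_ne_zero.mpr (NeZero.ne Lc))) (ctrOff_mem_box (Nat.one_le_iff_ne_zero.mpr (NeZero.ne Lc))) hM' hP hD₁ hD₂
      (((Lc : ℝ) ^ (d + 1) * stepScale d Lc j)⁻¹)
      (fun b : ↥(pbox (fine Lc M')) × Fin (d + 1) => h b + ∑ s, tgrad (fine Lc M') (b.1, Sum.inl b.2) s * lam s) hW'₁ hW'₂)
    -- `uLow` BY TERM: leaf-06's `torus_uLow_exp` — the fine block's Faddeev–Popov 2-jet vanishes on the small comb for the exponential jets, ANY `h`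
    (torus_uLow_exp M' (ctrOff_mem_box (Nat.one_le_iff_ne_zero.mpr (NeZero.ne Lc))) hτ₁ hD₁ D₂ (((Lc : ℝ) ^ (d + 1) * stepScale d Lc j)⁻¹) h
      (hW₁.trans (weightedJet_eq M' (((Lc : ℝ) ^ (d + 1) * stepScale d Lc j)⁻¹) h
        (fun (b : ↥(pbox (fine Lc M')) × Fin (d + 1)) (e : Res (ctr (d + 1) Lc) Lc M' ⊕ Res (ctr (d + 1) Lc) Lc (fine Lc M')) =>
          Sum.elim (fun t : Res (ctr (d + 1) Lc) Lc M' => tdelta M' (quo Lc ((b.1 : Site (d + 1)) + unitVec b.2)) t.1)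
            (fun s : Res (ctr (d + 1) Lc) Lc (fine Lc M') => tdelta (fine Lc M') ((b.1 : Site (d + 1)) + unitVec b.2) s.1) e)))
      hW₂)
    t2 hH₁t hH₂t a1 a2 c2 d2 hΓ hI hL hS hB h1 h2

end Summit.QuantumFields.BalabanUV.Beta.FP.NestedStepLawTorusTransportedRowsGradedGenSymULow

end
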